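/-
Copyright: b2b-lace packet (enumeration shard A, gen 64).  CM-pack-0: the closed-end-point (x = 0) total trail-count
majorant at d = 11 — the `N₀ : ℕ → ℕ` of the binders `hN : ∀ L, #trailWordsTo 11 L 0 ≤ N₀ L` of the repulsive-slot
consumers at the origin class.  Tables only (all counts are LANDED kernel theorems); no fact; no `sorry`.
-/
import Literature.Probability.FitznerVanDerHofstad2017.TrailCountTables
import Literature.Probability.FitznerVanDerHofstad2017.TrailCountTablesN10a
import Literature.Probability.FitznerVanDerHofstad2017.TrailCountTablesN12b
import Literature.Probability.FitznerVanDerHofstad2017.NbwCountExact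
import HarnessLib

/-!
# A total closed-trail majorant `N₀` at `d = 11` (origin end-point class)

Fitzner–van der Hofstad's notebook `Percolation.nb` (cell 11: `Bound[Bubble,m,s]`, `Bound[Triangle,m,s]`,
`Bound[Square,m,s]`) reads the bond-avoiding-walk (trail) counts `nrBAW[j,d,{0}]` returning to the origin for
`j ≤ Explicit`, and bounds everything beyond by non-backtracking walks ([NoBLE17] §5.3.1, (5.25): a trail is a
non-backtracking walk, so `a_L(0) ≤ b_L(0) ≤ 2d(2d−1)^{L−1}`).  The typed slot consumers of this packet
(`NobleExactLegSlots*`, `NobleTriangleLetterSums`, `NobleBubbleLetterSums`) take the origin-class counts through one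
total majorant `N₀ : ℕ → ℕ` with `hN : ∀ L, #trailWordsTo d L 0 ≤ N₀ L`.  This file packages, at the paper's own
dimension `d = 11`, the LANDED kernel-certified closed-trail counts `#trailWordsTo 11 L 0` for `L ≤ 12`
(`TrailCountTables`, `TrailCountTablesN10a`, `TrailCountTablesN12b`: 1, 0, 0, 0, 440, 0, 33000, 0, 4555760, 0,
718329040, 0, 132016199040), the parity zero at `L = 13`, and the non-backtracking total `22 · 21^{L−1}` beyond,
as `trailMajorantD11Zero` with the uniform bound `card_trailWordsTo_zero_le_trailMajorantD11Zero`.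
It is the `x = 0` companion of the `x ≠ 0` class-maximum majorant `trailMajorantD11` (module `TrailClassMaxD11N13`).

References: R. Fitzner, R. van der Hofstad, *Mean-field behavior for nearest-neighbor percolation in `d > 10`*,
Electron. J. Probab. 22 (2017) [FvdH17], §4.2 after (4.18) (arXiv:1506.07977v2 p. 36) and notebook `Percolation.nb`
cell 11; *Generalized approach to the non-backtracking lace expansion*, PTRF 169 (2017) [NoBLE17] §5.3.1 (5.25)
p. 1097; N. Madras, G. Slade, *The Self-Avoiding Walk* (1993) §1.2.
-/

namespace Literature.Probability.FitznerVanDerHofstad2017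

open Finset Literature.Probability.LatticeModels Literature.Probability.Percolation

/-- `siteOfList [] d` is the origin. [folklore] -/
private theorem siteOfList_nil_eq_zero (d : ℕ) : siteOfList [] d = 0 := by
  funext i; rfl

/-- Parity: no closed trail of odd length at `d = 11` (origin written as `0 : Site 11`). [folklore] -/
private theorem card_trailWordsTo_zero_d11_odd (n : ℕ) (h : n % 2 = 1) :
    (trailWordsTo 11 n (0 : Site 11)).card = 0 := by
  rw [← siteOfList_nil_eq_zero]
  exact card_trailWordsTo_eq_zero_of_odd n _ (by rw [l1Norm_siteOfList (by decide)]; simpa using h)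

/-- **Total closed-trail majorant at `d = 11`**: `N₀(L)` = the kernel-certified closed-trail count `a_L(0)` for
`L ≤ 12` (zero at odd `L`), `0` at `L = 13` (parity), and the total non-backtracking count `2d(2d−1)^{L−1}`
(`d = 11`) beyond — the shape `N₀ : ℕ → ℕ` the origin-class slot consumers take
(`hN : ∀ L, #trailWordsTo d L 0 ≤ N₀ L`).
[cite: FitznerVanDerHofstad2017, notebook Percolation.nb cell 11 (`Bound[Bubble,m,s]`, class {0} of `nrBAW`); §4.2 after (4.18) (arXiv:1506.07977v2 p. 36)] -/
def trailMajorantD11Zero (L : ℕ) : ℕ :=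
  if L ≤ 13 then
    [1, 0, 0, 0, 440, 0, 33000, 0, 4555760, 0, 718329040, 0, 132016199040, 0].getD L 0
  else 2 * 11 * (2 * 11 - 1) ^ (L - 1)

/-- **Uniform closed-trail bound at `d = 11`**: `a_L(0) ≤ N₀(L)` for every `L`
(`N₀ = trailMajorantD11Zero`: exact counts for `L ≤ 12`, parity zero at `L = 13`, `2d(2d−1)^{L−1}` beyond).
[cite: FitznerVanDerHofstad2017, notebook Percolation.nb cell 11 (`Bound[Bubble,m,s]`, class {0} of `nrBAW`); §4.2 after (4.18) (arXiv:1506.07977v2 p. 36)]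
[cite: FitznerVanDerHofstad2016NoBLE, §5.3.1 (5.25) p. 1097]
[cite: MadrasSlade1993, §1.2 (c_{N,2} = 2d(2d-1)^{N-1})] -/
theorem card_trailWordsTo_zero_le_trailMajorantD11Zero (L : ℕ) :
    (trailWordsTo 11 L (0 : Site 11)).card ≤ trailMajorantD11Zero L := by
  by_cases hL : L ≤ 13
  · interval_cases L
    · rw [← siteOfList_nil_eq_zero, card_trailWordsTo_n0_x0_d11]; decide +kernel
    · rw [card_trailWordsTo_zero_d11_odd 1 rfl]; exact Nat.zero_le _
    · rw [← siteOfList_nil_eq_zero, card_trailWordsTo_n2_x0_d11]; decide +kernel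
    · rw [card_trailWordsTo_zero_d11_odd 3 rfl]; exact Nat.zero_le _
    · rw [← siteOfList_nil_eq_zero, card_trailWordsTo_n4_x0_d11]; decide +kernel
    · rw [card_trailWordsTo_zero_d11_odd 5 rfl]; exact Nat.zero_le _
    · rw [← siteOfList_nil_eq_zero, card_trailWordsTo_n6_x0_d11]; decide +kernel
    · rw [card_trailWordsTo_zero_d11_odd 7 rfl]; exact Nat.zero_le _
    · rw [← siteOfList_nil_eq_zero, card_trailWordsTo_n8_x0_d11]; decide +kernel
    · rw [card_trailWordsTo_zero_d11_odd 9 rfl]; exact Nat.zero_le _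
    · rw [← siteOfList_nil_eq_zero, card_trailWordsTo_n10_x0_d11]; decide +kernel
    · rw [card_trailWordsTo_zero_d11_odd 11 rfl]; exact Nat.zero_le _
    · rw [← siteOfList_nil_eq_zero, card_trailWordsTo_n12_x0_d11]; decide +kernel
    · rw [card_trailWordsTo_zero_d11_odd 13 rfl]; exact Nat.zero_le _
  · rw [trailMajorantD11Zero, if_neg hL]
    exact (card_trailWordsTo_le_card_nbwWordsTo 11 L 0).trans (card_nbwWordsTo_le_pow 11 (by omega) 0)

/-- The table values of `trailMajorantD11Zero` for `L ≤ 13` (kernel evaluation, for consumers' `norm_num`).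
[cite: FitznerVanDerHofstad2017, notebook Percolation.nb cell 11 (`Bound[Bubble,m,s]`, class {0} of `nrBAW`)] -/
theorem trailMajorantD11Zero_values :
    trailMajorantD11Zero 0 = 1 ∧ trailMajorantD11Zero 1 = 0 ∧ trailMajorantD11Zero 2 = 0 ∧
    trailMajorantD11Zero 3 = 0 ∧ trailMajorantD11Zero 4 = 440 ∧ trailMajorantD11Zero 5 = 0 ∧
    trailMajorantD11Zero 6 = 33000 ∧ trailMajorantD11Zero 7 = 0 ∧ trailMajorantD11Zero 8 = 4555760 ∧
    trailMajorantD11Zero 9 = 0 ∧ trailMajorantD11Zero 10 = 718329040 ∧ trailMajorantD11Zero 11 = 0 ∧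
    trailMajorantD11Zero 12 = 132016199040 ∧ trailMajorantD11Zero 13 = 0 := by
  decide +kernel

/-- The exact entries: for even `L ≤ 12` the majorant IS the closed-trail count.
[cite: FitznerVanDerHofstad2017, notebook Percolation.nb cell 11 (`Bound[Bubble,m,s]`, class {0} of `nrBAW`)] -/
theorem card_trailWordsTo_zero_eq_trailMajorantD11Zero {L : ℕ} (hL : L ≤ 12) (h : L % 2 = 0) :
    (trailWordsTo 11 L (0 : Site 11)).card = trailMajorantD11Zero L := by
  interval_cases L <;> first | exact absurd h (by decide) | skip
  · rw [← siteOfList_nil_eq_zero, card_trailWordsTo_n0_x0_d11]; decide +kernel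
  · rw [← siteOfList_nil_eq_zero, card_trailWordsTo_n2_x0_d11]; decide +kernel
  · rw [← siteOfList_nil_eq_zero, card_trailWordsTo_n4_x0_d11]; decide +kernel
  · rw [← siteOfList_nil_eq_zero, card_trailWordsTo_n6_x0_d11]; decide +kernel
  · rw [← siteOfList_nil_eq_zero, card_trailWordsTo_n8_x0_d11]; decide +kernel
  · rw [← siteOfList_nil_eq_zero, card_trailWordsTo_n10_x0_d11]; decide +kernel
  · rw [← siteOfList_nil_eq_zero, card_trailWordsTo_n12_x0_d11]; decide +kernel

/-- Odd lengths: the majorant vanishes for odd `L ≤ 13` (and so does the count, by parity).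
[cite: FitznerVanDerHofstad2017, notebook Percolation.nb cell 11 (`Bound[Bubble,m,s]`, class {0} of `nrBAW`)] -/
theorem trailMajorantD11Zero_eq_zero_of_odd {L : ℕ} (hL : L ≤ 13) (h : L % 2 = 1) :
    trailMajorantD11Zero L = 0 := by
  interval_cases L <;> first | exact absurd h (by decide) | decide +kernel

/-- Beyond the tables: `trailMajorantD11Zero L = 22 · 21^{L−1}` for `14 ≤ L`.
[cite: MadrasSlade1993, §1.2 (c_{N,2} = 2d(2d-1)^{N-1})] -/
theorem trailMajorantD11Zero_of_le {L : ℕ} (hL : 14 ≤ L) : trailMajorantD11Zero L = 22 * 21 ^ (L - 1) := by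
  rw [trailMajorantD11Zero, if_neg (by omega)]

/-- Consumer form: the origin-class count hypothesis of the slot lemmas, discharged at `d = 11`.
[cite: FitznerVanDerHofstad2017, notebook Percolation.nb cell 11 (`Bound[Bubble,m,s]`, class {0} of `nrBAW`)] -/
theorem forall_card_trailWordsTo_zero_le_trailMajorantD11Zero :
    ∀ L, (trailWordsTo 11 L (0 : Site 11)).card ≤ trailMajorantD11Zero L :=
  card_trailWordsTo_zero_le_trailMajorantD11Zero

end Literature.Probability.FitznerVanDerHofstad2017
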